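import Mathlib
import HarnessLib
import HarnessLib.Audit
import Summits.ValiantsHypothesis.Statement
import Literature.Computability.AlgebraicComplexity.DeterminantalComplexity
import Literature.Computability.AlgebraicComplexity.ValiantConjectureProofs
import HarnessLib.Audit.Status.Attr

/-!
Route: ImmanantSlice

DORMANT since 2026-08-27T20:19:20Z (DORMANT-CALIBRATED (director-valiant g8 D1=(A), INBOX 20:18:55Z; sweep g3): #201 SliceVBP = 17992 RESIDUAL·HELD; #202 DcTwoClassRigidity 21291 ⟹ W = DcPerSuperpolynomial ℂ (kernel dcPerSuperpolynomial) — unstaffed, not closed; items shared with open routes are served there. `ledger route dormant <id> --off` reactivates.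

# Route ImmanantSlice — cuspidal rigidity — VP-cheap class functions are sign-like on long cycles

It suffices to show CUSPIDAL RIGIDITY (CR, card cuspidal-rigidity-immanant-slice): work on Schur's
slice of generalized matrix
functions d_χ(X) = Σ_σ χ(σ) Π_i x_{σ(i),i} for coefficient functions χ_n : S_n → ℂ that are CLASS
FUNCTIONS (det = d_sgn,
per = d_1, HC_n, fermionants, immanants). CR: for every p-family of class functions χ_n with
(d_{χ_n})_n ∈ VP_ℂ there are k, n₀
such that for all n ≥ n₀ the restriction of χ_n to Π_k(n) := {σ fixed-point-free, every cycle of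
length > k} is a scalar
multiple of sgn ("a polynomial-size circuit senses the long-cycle structure of a permutation only
through the sign"). Since
per_n = d_1 and the trivial character is NOT sign-like on Π_k(n) for n ≥ 2k+2 (the n-cycle and an
(a, n−a)-product have
opposite signs), CR ⇒ per ∉ VP ⇒ VP_ℂ ≠ VNP_ℂ. The load-bearing fragment is the two-class form (crux
TwoClassRigidity); CR is
the structural target; PermanentDominance / EvenCycleDominance are the unconditional (reduction)
content, MonotoneRigidity the
monotone shadow.
Lean: `∀ χ : (n : ℕ) → Equiv.Perm (Fin n) → ℂ, (∀ n (σ τ : Equiv.Perm (Fin n)), IsConj σ τ → χ n σ =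
χ n τ) → Literature.Computability.AlgebraicComplexity.IsVPFamily (fun n => ∑ σ : Equiv.Perm (Fin n),
MvPolynomial.C (χ n σ) * ∏ i : Fin n, MvPolynomial.X (σ i, i)) → ∃ k n₀ : ℕ, ∀ n, n₀ ≤ n → ∃ c : ℂ,
∀ σ : Equiv.Perm (Fin n), (∀ i, σ i ≠ i) → (∀ m ∈ σ.cycleType, k < m) → χ n σ = c *
((Equiv.Perm.sign σ : ℤ) : ℂ)`

## Assembly
Pure logic plus proved cone facts: apply TwoClassRigidity to χ ≡ 1 (a class function) whose d_χ is
perPoly (Fin n) ℂ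
(simp: C 1 * Π X(σ i, i), Matrix.permanent of mvPolynomialX); if per were a VP family we would get
k, n₀ and, at
n = max(n₀, 2k+2) with a = k+1, an n-cycle σ (finRotate) and a product τ of two long cycles with 1 =
−1 in ℂ — absurd; so
¬ IsVPFamily (fun n => perPoly (Fin n) ℂ), and
Summit.ValiantsHypothesis.Hub.valiantsHypothesis_of_not_isVPFamily_per with
mem_VP_ofFintype_iff_holds and perFamily_mem_VNP_holds (all proved in tree) gives VP_ℂ ≠ VNP_ℂ.
CuspidalRigidity feeds in
through TargetToTwoClass.

UNDER FLOOR: fewer than 2 cruxes remain after retriage (legacy route; D-0019).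

Rationale: WHY THIS LINE. The class-function slice {d_χ : χ ∈ CF(S_n)} is canonical (the
row/column-multilinear, simultaneous-conjugation-invariant part
of Sym^n(ℂ^{n×n})), has SUBEXPONENTIAL dimension p(n) = e^{O(√n)}, and VP-cheapness on it is closed
under sums, so a lower
bound is witnessed by a DEGREE-ONE distinguisher: a cusp form ψ_n ⟂ every cheap χ with ⟨ψ_n, 1⟩ ≠ 0
— the one regime where
the Forbes–Shpilka–Volk obstruction (ForbesShpilkaVolk2018, GrochowKumarSaksSaraf2017) cannot bite
in its own terms (no ψ ⇔
cheap class functions span CF(S_n) ⇔ L(per_n) ≤ p(n)·n^c = 2^{O(√n)}). Forty years of immanant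
complexity are the consistency
checks: every known easy d_χ lies in the cone End1 + End2 = {sgn·F(c_1)·P(c_2..c_k)} + {χ supported
on permutations moving
O(1) points} (Hartmann1985, Burgisser2000Immanants, MertensMoore2013, DeRugyAltherre2013) and
Curticapean2021 Thm 1 proves
exactly CR's dichotomy line for irreducible characters (imm_λ ∈ VP iff b(λ) bounded, VNP-complete
for b(λ) ≥ n^α); CR
extends the line from characters to all class functions and turns it into an implication TO VH.
Imported areas: character
theory / symmetric functions (Frobenius CF(S_n) = Λ_n: restriction, induction and short-cycle
Laplace operators act as p_j,
∂/∂p_j, a partial Weyl algebra preserving the cheap cone), parameterized counting complexity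
(Curticapean's gadgets) for the
reduction cruxes, Jerrum–Snir monotone counting for the monotone shadow. No prior route (DetQP,
GCTMult, IntegralGCT, Depth4,
Elusive, TauConst, BoolTransfer) touches immanants, class functions or linear certificates;
negatives index empty.

RANKED CRUXES. #0 CuspidalRigidity (target) — CR as in § Thesis: every VP p-family of class
functions χ_n : S_n → ℂ is, for some k and all large n, a scalar multiple (depending on n) of sgn on
Π_k(n) = {σ : no fixed point, all cycles longer than k}. (why it might fail: one VP family of class
functions with genuinely cuspidal support kills it — prime suspects D^even_n = Σ_{all cycles even}
sgn(σ)x^σ = [z^{[n]}]√(det(I−ZX)det(I+ZX)) and T_n = Σ sgn(σ)c(σ)x^σ = ∂_u [z^{[n]}]det(I+ZX)^u at u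
= 1.) [Curticapean2021, Burgisser2000Immanants, Hartmann1985, MertensMoore2013, DeRugyAltherre2013,
ForbesShpilkaVolk2018]
#2 TwoClassRigidity (crux) — the cusp form ψ = 1_{(n)}/|(n)| + 1_{(a,n−a)}/|(a,n−a)| annihilates the
cheap cone: for every VP p-family of class functions χ_n there are k, n₀ with χ_n(n-cycle) =
−χ_n(type (a, n−a)) for all n ≥ n₀ and all a with k < a, k < n−a (CR restricted to the two classes
(n), (a,n−a); already implies VH since per = d_1 gives 1 = −1). Card Crux 2. [difficulty:
open-problem] (why it might fail: VH-hard as a theorem; false iff some VP class-function family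
separates the n-cycle class from a two-long-cycle class other than by sign — e.g. if T_n = Σ
sgn(σ)c(σ)x^σ (values ∓1 vs ±2 there) or D^even_n (−1 vs 0 at a odd) were in VP.) [Curticapean2021,
Burgisser2000Immanants, MertensMoore2013, DeRugyAltherre2013, Valiant1979] [rev 4 (tenure g1, A4,
2026-08-27): SPLIT (gen 1) into SliceVBP (#201, RESIDUAL) ∧ DcTwoClassRigidity (#202, ATTACKED) with
the proved glue item TwoClassRigidityOfDcSplit (#203); `closes` still consumes TwoClassRigidity
itself (single binder), now reached through the split; TwoClassRigidity alone already gives VH (this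
file's `closes`), which is why it is redirected into two weaker pieces; direct attempts low
priority.]
#201 SliceVBP (crux) — RESIDUAL · HELD (not staffed) · split child 1 of TwoClassRigidity · ONE
shared item stmt-17992 = TwistedDetRank.SliceVPInVBP verbatim — COLLAPSE side: the class-function
slice of VP lies in VBP (p-computable class-function GMF family ⇒ dc(f_n) ≤ n^c + c).
SUMMIT-CALIBRATED by the first prover val-width-17992-p1
(Theorems/TwistedDetRankSliceVPInVBPCalibration.lean, p551099 + p552122;
Cruxes/SliceVPInVBP/CALIBRATION.md): `dcPerSuperpolynomial_of_not_sliceVPInVBP` (¬SliceVBP →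
DcPerSuperpolynomial ℂ = VNP ⊄ VP_ws), `valiantsHypothesis_of_sliceVPInVBP_of_dcPerSuperpolynomial`
(SliceVBP → DcPerSuperpolynomial ℂ → VH), `sliceVPInVBP_or_dcPerSuperpolynomial` (SliceVBP ∨
DcPerSuperpolynomial ℂ outright), `sliceVPInVBP_iff`; the two typings (this route's
IsVPFamily/IsPBounded-dc form and TwistedDetRank's IsPComputable/HasDetRepr form) are proved
equivalent (`sliceVBP_of_sliceVPInVBP` / `sliceVPInVBP_of_sliceVBP`,
Theorems/ImmanantSliceTwoClassRigiditySplit.lean p552055). DECLARED THIS ROUTE'S RESIDUAL = the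
imported complement of the conjunct split TwoClassRigidity ⇐ SliceVBP ∧ DcTwoClassRigidity (tribunal
T1′ rule; director-valiant g8 rulings 2026-08-27T17:43:59Z and 17:52:55Z): not staffed (item HELD on
the ledger 2026-08-27T18:14Z with this declaration as the hold note), no further provers, exempt
from T3/T4, counted ONCE per summit together with TwistedDetRank; tribunal flag `--residual
SliceVBP`. Ledger kind stays `crux`: the gate has no `residual` kind and re-promotes a load-bearing
`aside` to crux (cone.rekinded.repromoted, seen on TwistedDetRank rev 8 → 9 / rev 11), so the HOLD +
this paragraph carry the declaration. ATTACKED CONJUNCT of this route = DcTwoClassRigidity (#202).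
[MalodPortier2008, Burgisser2000, MignonRessayre2004, DawarPagoSeppelt2025, RazYehudayoff2008,
MahajanVinay1997]
#202 DcTwoClassRigidity (crux) — ATTACKED CONJUNCT · split child 2 · stmt-21291 —
DeterminantalRigidity restricted to permutations with at most two cycles: every class-function
family whose GMFs have p-bounded affine determinantal complexity is, for some k, n₀ and all n ≥ n₀,
c_n·sgn on the ≤2-cycle part of Π_k(n). Placements landed
(Theorems/ImmanantSliceTwoClassRigiditySplit.lean): TwoClassRigidity → it
(`dcTwoClassRigidity_of_twoClassRigidity`), DeterminantalRigidity → it, it → DcPerSuperpolynomial ℂ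
(`dcPerSuperpolynomial_of_dcTwoClassRigidity`: VNP ⊄ VP_ws — it does NOT give VH alone; together
with the residual it gives TwoClassRigidity, hence VH). [difficulty: open-problem, at least
per-versus-det] (why it might fail: refuted by a polynomial determinantal expression for any
class-function family separating (n) from (a, n−a) beyond sign — T_n = Σ sgn·c(σ)x^σ (∓1 vs ±2) or
D^even_n (−1 vs 0, a odd); dc kill switches already in tree.) [Valiant1979, MignonRessayre2004,
LandsbergGCT2017, Curticapean2021, MertensMoore2013]
#203 TwoClassRigidityOfDcSplit (support) — glue · stmt-21292 — SliceVBP → DcTwoClassRigidity →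
TwoClassRigidity (an n-cycle and a type-(a, n−a) permutation, k < a, k < n−a, both lie in the
≤2-cycle part of Π_k(n) with opposite signs); PROVED verbatim by
`Summit.ValiantsHypothesis.Theorems.TwoClassRigiditySplit.twoClassRigidity_of_sliceVPInVBP_of_dcTwoClassRigidity`
(p552055; statement-close by a prover/operator pending, planner ACL cannot). [Burgisser2000]
#3 PermanentDominance (aside) — was crux — the hard direction of a CLASS-FUNCTION dichotomy
(Curticapean2021 Thm 1 is the character case), in implication form: if a p-family of class functions
χ_n is NOT eventually sign-like on any Π_k (for every k, n₀ some n ≥ n₀ where χ_n|Π_k(n) is not a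
multiple of sgn) and (d_{χ_n}) ∈ VP, then the permanent is p-computable. Equivalent to (VH → CR): it
says CR costs nothing beyond VH; intended proofs are c-reductions per ≤ d_χ (gadgets + interpolation
along the F(c_1)-twist and j-cycle insertions). [difficulty: XL] (why it might fail: fails iff VH
holds but CR does not: a non-sign-like class-function family of INTERMEDIATE complexity (Bürgisser's
Ladner-type families exist in VNP∖VP under VH, Burgisser2000 Ch. 5) sitting on the slice; sparse
'infinitely often' violations may defeat uniform reductions.) [Curticapean2021, Burgisser2000,
Burgisser2000Immanants, MertensMoore2013, Valiant1979]
#4 EvenCycleDominance (crux) — the prime suspect is permanent-hard: if the signed even-cycle-cover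
family D^even_n = Σ_{σ ∈ S_n, no fixed points, all cycles even} sgn(σ) Π x_{σ(i),i} (χ = sgn·[all
cycles even], a class function violating sign-likeness at every even n; equals det on skew-symmetric
X) is in VP then per is p-computable. First instance of PermanentDominance beyond characters and the
fermionant line; a gadget/interpolation reduction in the style of Curticapean2021 §1.2 /
MertensMoore2013 is the intended proof. [difficulty: L] (why it might fail: D^even =
[z^{[n]}]√(det(I−(ZX)²)) may carry a Pfaffian-type polynomial-size formula for general X (it is Pf²
on skew X; even directed circuits have Pfaffian-orientation structure, RobertsonSeymourThomas1999) —
then it is VP-cheap and no reduction exists unless VH fails.) [MertensMoore2013, Curticapean2021,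
RobertsonSeymourThomas1999, Valiant1979]
#5 MonotoneRigidity (crux) — the monotone shadow of CR (a necessary condition for CR, since a
monotone circuit over ℝ≥0 is a circuit over ℂ and a nonnegative χ positive on a long-cycle class is
never c·sgn): if χ_n : S_n → ℝ≥0 are class functions and d_{χ_n} has Jerrum–Snir monotone
computations of p-bounded size, then for some k and all large n, χ_n vanishes on Π_k(n). Card
support (c). [difficulty: M] (why it might fail: JS counting is per-polynomial: block gadgets
project d_χ only to another d_{χ''} with χ''(id) > 0 (cheap when χ'' = δ_id), not to per_t, so mixed
cycle types (t ≈ L ≈ √n) need a new support-insensitive 2^{Ω(n^{1/3})} bound; a positive cheap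
example would refute CR itself.) [JerrumSnir1982, Valiant1980, Curticapean2021]
#9 DeterminantalRigidity (support) — the VBP special case of CR (weaker statement, implies VBP ≠
VNP): class-function families whose d_χ have p-bounded affine determinantal complexity are
eventually sign-like on some Π_k. [difficulty: open-problem] [MignonRessayre2004, Valiant1979,
Curticapean2021]
#9 EvenCycleCoverNotVP (aside) — since rev 5, was support — CR's sharpest single prediction, filed
so that its REFUTATION (D^even ∈ VP, the route's kill switch) has a decl to close: the signed
even-cycle-cover family is not in VP. [difficulty: open-problem] [MertensMoore2013,
RobertsonSeymourThomas1999] [rev 5: ASIDE — it implies the summit on its own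
(`valiantsHypothesis_of_evenCycleCoverNotVP`) and is not in the cone of `closes`; kept only as the
kill-switch decl.]
#9 AlphaPencil (support) — α-pencil interpolation lemma (card (6), rigorous): if for some c and
every n at least n+1 distinct α ∈ ℂ have L(per_{α,n}) ≤ n^c + c, where per_{α,n} = Σ_σ
α^{#cycles(σ)} x^σ (cycles counted with fixed points), then the permanent is p-computable (Lagrange
interpolation in α recovers every C_k = Σ_{c(σ)=k} x^σ, hence per_n = Σ_k C_k, with
complexity_add_le/smul_le). [difficulty: provable-now] [MertensMoore2013, DeRugyAltherre2013,
Burgisser2000]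
#9 TargetToTwoClass (support) — CR implies the two-class form (sign bookkeeping: sgn of an n-cycle
is (−1)^{n−1}, of type (a, n−a) is (−1)^n; both classes lie in Π_k(n) when k < a, k < n−a;
Equiv.Perm.sign_of_cycleType). [difficulty: provable-now] [Burgisser2000]

TWO-LAYER PLAN. Foreseen glued splits (none filed now). TwoClassRigidity ⇐ OperatorStability (the
span V_n of cheap class functions is
closed at poly cost under restriction S_n → S_{n−1}, induction, removal/insertion of a j-cycle and
c_j-multiplication for
j = O(1), and arbitrary F(c_1)-twists — provable bookkeeping) → CuspidalProjection (a subspace of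
Λ_n stable under these
p_j, ∂/∂p_j, containing e_n, of poly-bounded 'cost filtration', has cuspidal projection on the sign
line — the algebraic
heart) → TwoClassRigidity. PermanentDominance ⇐ single-long-class case (HC-like supports,
Valiant/Curticapean gadgets) →
nowhere-zero multiplicative weights (fermionant line, MertensMoore2013/DeRugyAltherre2013 +
AlphaPencil) → general χ by
interpolation over twists. MonotoneRigidity ⇐ SingleClassMonotone (every fixed-point-free class sum
needs 2^{Ω(n^{1/3})}
product gates: long-cycle regime via HC counting, many-cycles regime via block matchings) →
PositivityTransfer (nonnegative
combinations inherit the bound on Π_k-classes) → MonotoneRigidity.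

KILL CRITERIA. An explicit VP family of class functions violating sign-likeness on long cycles
refutes CuspidalRigidity; if it also
separates (n) from some (a, n−a) beyond sign (D^even at odd a, T_n) it refutes TwoClassRigidity and
the route closes
`refuted:TwoClassRigidity` (the witness goes to the negatives index as 'cheap cuspidal class
function'). A refutation of
MonotoneRigidity (nonnegative cheap family positive on long classes) refutes CR outright — close. A
witness violating CR but
respecting the two classes forces a pivot: target := TwoClassRigidity only, rationale rewritten
around the specific cusp
form. EvenCycleCoverNotVP refuted (D^even ∈ VP) ⇒ close unless the circuit is 2^{Ω(√n)}-ish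
quasi-refutation only.
PermanentDominance/EvenCycleDominance cannot be refuted without proving VH; if VH is proved
elsewhere the assembly is moot
but CR, PD stay meaningful as structure theorems (hand to Literature). RESIDUAL BOOKKEEPING (rev 6,
tenure g2): SliceVBP (stmt-17992, #201) is NOT attacked on this route — its refutation would PROVE
DcPerSuperpolynomial ℂ (`dcPerSuperpolynomial_of_not_sliceVPInVBP`); bank it, and the route's honest
reach is then DcTwoClassRigidity → DcPerSuperpolynomial ℂ (FRONTIER reading, 21-frontier's ledger).
DcTwoClassRigidity (#202) refuted by a polynomial-dc class-function family separating (n) from (a,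
n−a) beyond sign ⇒ TwoClassRigidity is refuted with it (`dcTwoClassRigidity_of_twoClassRigidity`
landed) ⇒ close `refuted:TwoClassRigidity` as above.

NOT DECOMPOSED YET. The operator calculus (End1/End2 upper bounds: sgn·F(c_1)·P(c_2..c_k) and
bounded-support χ are VP; closure of the cheap
cone under restriction/induction/insertion) — provable-now lemmas, attached later with --supports;
the VQP version of CR
(k = polylog n); the Λ_n/ω reformulation (VH ⇔ cheap cone of Λ not ω-stable); a c-reduction notion
in Lean (PD is stated in
implication form to avoid it); Specht character polynomials (needed to re-derive Curticapean's easy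
direction inside CR);
the symmetric-circuit rung (Dawar–Wilsenach) which belongs to card symmetry-restoration-wl.

CHEAPEST FALSIFIER. Decide the status of D^even_n = [z^{[n]}]√(det(I−ZX)det(I+ZX)): (1)
literature/identity check for a Pfaffian or
determinantal formula valid for GENERAL X (Knuth overlapping Pfaffians, Stembridge path Pfaffians,
RST 1999 even-circuit
theory; it is Pf(X)² = det X on skew X) — a hit kills the route; (2) kit: affine determinantal
complexity of D^even_4 and
D^even_6 by Gröbner/numerical ansatz (is dc(D^even_4) ≤ 5, tracking det_4, or ≥ 7, tracking
per_3/per_4?), and #P-hardness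
of X ↦ D^even(X) on 0/±1 matrices by interpolation from even-cycle-cover counting. Second test: T_n
= Σ sgn(σ)c(σ)x^σ =
det X + Σ_{k≥2} (−1)^k (k−2)! B_k (B_k = Σ over set partitions into k blocks of products of
principal minors) — any
polynomial-size formula kills TwoClassRigidity. Not run here (hub is compute-free; lit local index
unreachable this session).

NUMBERS. Slice dimension p(n) ~ exp(π√(2n/3))/(4√3 n) (Hardy–Ramanujan); FSV-type obstruction on the
slice would need
L(per_n) ≤ p(n)·n^c = 2^{O(√n)} vs Ryser 2^n·n (best known) and Grenet dc(per_n) ≤ 2^n − 1. Easy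
side: imm_λ in
O(n^{6 b(λ)+4}) time, b(λ) = n − #parts (Curticapean2021 §1 citing Hartmann1985/Bürgisser/Barvinok);
hard side: VNP-complete
when b(λ) ≥ n^α (Curticapean2021 Thm 1), not in VP unless VFPT = VW when b → ∞ (Thm 2). Fermionant
line: only k = 1 (det)
easy; Ferm_2 ⊕P-hard, Ferm_k #P-hard for k ≥ 3 (MertensMoore2013). Monotone: per_n needs exactly
n(2^{n−1} − 1) product
gates (JerrumSnir1982 §4.3, proved in tree as JerrumSnir1982_permanent_holds). Items at open: 10 (1
target, 4 cruxes,
4 support, 1 assembly).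

DEFINITION REQUESTS. genMatrixPoly (generalized matrix function / f-immanant of a coefficient
function χ : Equiv.Perm n → k, = Σ_σ C (χ σ) *
Π_i X (σ i, i), with eval lemma, per/det/HC special cases, IsClassFunction predicate and the Π_k(n)
predicate) in
Literature/Computability/AlgebraicComplexity — filed after open with `ledger workitem add --kind
definition`; all items above
inline the sum so nothing waits on it.

Novelty: Searches (2026-08-15): `lit search --source crossref "full complexity dichotomy immanant families"`
(1 relevant:
doi:10.1145/3406325.3451124); `… "computational complexity of immanants"` (3:
doi:10.1137/s0097539798367880,
doi:10.1080/03081088508817680, Bürgisser 2000 ch.); `… "fermionant complexity immanants constant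
width"` /
`lit cite 10.4086/toc.2013.v009a006` (MertensMoore2013); `… "determinant versus permanent salvation
via generalization"`
(doi:10.1007/978-3-642-39053-1_10); `… "alpha permanent computational complexity"` (0 relevant); `…
"even cycle cover
counting Pfaffian signed"` (1: doi:10.2307/121059); `… "symmetric arithmetic circuits permanent
Dawar Wilsenach"`
(doi:10.4086/toc.2025.v021a014, other card); `lit galaxy search "immanant" --star all` (12 pdf rows,
none on complexity of
class-function immanants; panama/crabby queue timeouts); `lit read arxiv:2102.04340 --grep
dichotomy` (Thm 1/Thm 2 read,
pp. 4–5: dichotomy is for irreducible characters by b(λ); general class functions not classified);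
local `lit search`
index unreachable (searchd reset) — recorded in NOTES. `ledger negatives --problem
ValiantsHypothesis`: 0.
Nearest prior art found: Curticapean2021 (doi:10.1145/3406325.3451124, Thm 1–2: character immanant
families, b(λ) line);
MertensMoore2013 + DeRugyAltherre2013 (the α/fermionant pencil: only det cheap); Hartmann1985 /
Burgisser2000Immanants
(n^{O(b)} algorithms, VNP-completeness of immanants); ForbesShpilkaVolk2018 (natural-proof barrier,
degree ≥  [refs: 10.1145/3406325.3451124, 10.1137/s0097539798367880, 10.1080/03081088508817680, 10.4086/toc.2013.v009a006`, 10.1007/978-3-642-39053-1_10, 10.2307/121059, 10.4086/toc.2025.v021a014, 2102.04340, doi:10.1145/3406325.3451124, doi:10.1137/s0097539798367880, doi:10.1080/03081088508817680, doi:10.1007/978-3-642-39053-1_10, doi:10.2307/121059, doi:10.4086/toc.2025.v021a014, arxiv:2102.04340, MertensMoore20]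

Barriers (technique_class: immanant-dichotomy, linear-slice-distinguisher): - technique_class: immanant-dichotomy, linear-slice-distinguisher
- Literature.Barriers.ValiantsHypothesis.AlgebraicNaturalProofs: the certificate is a degree-ONE
distinguisher restricted to the p(n)-dimensional slice; the succinct-hitting-set hypothesis
specialised to this class says cheap class functions span CF(S_n), i.e. L(per_n) ≤ p(n)·n^c =
2^{O(√n)} — so the barrier's premise is itself a sub-Ryser upper bound for per; evaded in its own
terms (honest caveat: existence of ψ is cheap, an explicit ψ WITH PROOF is crux TwoClassRigidity).
- Literature.Barriers.ValiantsHypothesis.RankMethods: not engaged — flattening/partial-derivative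
ranks of d_χ depend only on supp χ, identical for det, per and every nowhere-zero χ; CR is about
VALUES of χ (linear, not rank-like).
- Literature.Barriers.ValiantsHypothesis.RankLifting: same remark; no lifted rank measure is used.
- Literature.Barriers.ValiantsHypothesis.PartialDerivativesDetPerm: same remark (det and per have
equal partial-derivative profiles; the line never compares them by derivatives).
- Literature.Barriers.ValiantsHypothesis.ShiftedPartialsCannotSeparate: not engaged (no shifted
partials, no depth reduction).
- Literature.Barriers.ValiantsHypothesis.PermanentCharTwo: consistent and instructive — in
characteristic 2 sgn = 1 and CR's conclusion reads 'constant on long cycles', which per satisfies;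
the route is over ℂ and uses char ≠ 2 exactly where 1 ≠ −1 enters (Assembly), while the operator
calculus is characteristic-fre

History (route lifecycle, newest last):
- 2026-08-15T16:16:04Z · rev 1: restated MonotoneRigidity (stmt-ValiantsHypothesis-4212) — route-repair (cone guardrail): restate MonotoneRigidity 1:1 with Literature.Barriers.ValiantsHypothesis.IsMonotoneComputation unfolded in place (fan-in-two ∧ pl (planner-rbadge-ValiantsHypothesis-ImmanantSlic-220df893-g2-0)
- 2026-08-22T04:30:21Z · DORMANT — reconciler: no traction for 5.1 d (last activity item-evidence-added at 2026-08-17T02:22:58Z); parked, not closed — `ledger route dormant route-ValiantsHypothes (operator:999:3352614)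
- 2026-08-27T06:27:13Z · REACTIVATED — reconciler: reactivated — activity item-proof-filed at 2026-08-27T04:44:10Z after parking at 2026-08-22T04:30:21Z (operator:999:1896458)
- 2026-08-27T20:19:20Z · DORMANT — DORMANT-CALIBRATED (director-valiant g8 D1=(A), INBOX 20:18:55Z; sweep g3): #201 SliceVBP = 17992 RESIDUAL·HELD; #202 DcTwoClassRigidity 21291 ⟹ W = DcPerSuperp (planner-tenure-valiant-dormant-sweep-g3-0)

sub-problem: ValiantsHypothesis · status: dormant · opened planner-plancard-ValiantsHypothesis-ValiantsH-cb7bac22-0 2026-08-15T11:29:50Z · rev 6 · ledger route-ValiantsHypothesis-ImmanantSlice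
GENERATED by the gate from the ledger (D-0016/17). Provers cite these decls: `theorem foo : Summit.ValiantsHypothesis.ValiantsHypothesis.Theses.ImmanantSlice.<Decl> := …` in Summits/ValiantsHypothesis/ValiantsHypothesis/Theorems/<Name>.lean.
-/

namespace Summit.ValiantsHypothesis.ValiantsHypothesis.Theses.ImmanantSlice

open scoped BigOperators Topology Manifold Classical MeasureTheory ProbabilityTheory Matrix InnerProductSpace ComplexConjugate ContinuousMap
open Filter Set Function TopologicalSpace MeasureTheory

attribute [summit_statement] _root_.ValiantsHypothesis

open Literature.PNP

/-- item stmt-ValiantsHypothesis-4208 · target · rank 0 · open · by planner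
why it might fail: one VP family of class functions with genuinely cuspidal support kills it — prime suspects D^even_n = Σ_{all cycles even} sgn(σ)x^σ = [z^{[n]}]√(det(I−ZX)det(I+ZX)) and T_n = Σ sgn(σ)c(σ)x^σ = ∂_u [z^{[n]}]det(I+ZX)^u at u = 1.
sources: Curticapean2021, Burgisser2000Immanants, Hartmann1985, MertensMoore2013, DeRugyAltherre2013, ForbesShpilkaVolk2018
[target] CR as in § Thesis: every VP p-family of class functions χ_n : S_n → ℂ is, for some k and
all large n, a scalar multiple (depending on n) of sgn on Π_k(n) = {σ : no fixed point, all cycles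
longer than k}. -/
@[route_item "route-ValiantsHypothesis-ImmanantSlice", crux]
def CuspidalRigidity : Prop :=
  ∀ χ : (n : ℕ) → Equiv.Perm (Fin n) → ℂ, (∀ n (σ τ : Equiv.Perm (Fin n)), IsConj σ τ → χ n σ = χ n τ) → Literature.Computability.AlgebraicComplexity.IsVPFamily (fun n => ∑ σ : Equiv.Perm (Fin n), MvPolynomial.C (χ n σ) * ∏ i : Fin n, MvPolynomial.X (σ i, i)) → ∃ k n₀ : ℕ, ∀ n, n₀ ≤ n → ∃ c : ℂ, ∀ σ : Equiv.Perm (Fin n), (∀ i, σ i ≠ i) → (∀ m ∈ σ.cycleType, k < m) → χ n σ = c * ((Equiv.Perm.sign σ : ℤ) : ℂ)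

/-- item stmt-ValiantsHypothesis-4209 · crux · rank 2 · SPLIT (gen 1) into SliceVBP, DcTwoClassRigidity + glue TwoClassRigidityOfDcSplit · direct attempts still welcome (low priority) · by planner
why it might fail: VH-hard as a theorem; false iff some VP class-function family separates the n-cycle class from a two-long-cycle class other than by sign — e.g. if T_n = Σ sgn(σ)c(σ)x^σ (values ∓1 vs ±2 there) or D^even_n (−1 vs 0 at a odd) were in VP.
sources: Curticapean2021, Burgisser2000Immanants, MertensMoore2013, DeRugyAltherre2013, Valiant1979
[crux] the cusp form ψ = 1_{(n)}/|(n)| + 1_{(a,n−a)}/|(a,n−a)| annihilates the cheap cone: for every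
VP p-family of class functions χ_n there are k, n₀ with χ_n(n-cycle) = −χ_n(type (a, n−a)) for all n
≥ n₀ and all a with k < a, k < n−a (CR restricted to the two classes (n), (a,n−a); already implies
VH since per = d_1 gives 1 = −1). Card Crux 2. [difficulty: open-problem] -/
@[route_item "route-ValiantsHypothesis-ImmanantSlice", crux]
def TwoClassRigidity : Prop :=
  ∀ χ : (n : ℕ) → Equiv.Perm (Fin n) → ℂ, (∀ n (σ τ : Equiv.Perm (Fin n)), IsConj σ τ → χ n σ = χ n τ) → Literature.Computability.AlgebraicComplexity.IsVPFamily (fun n => ∑ σ : Equiv.Perm (Fin n), MvPolynomial.C (χ n σ) * ∏ i : Fin n, MvPolynomial.X (σ i, i)) → ∃ k n₀ : ℕ, ∀ n, n₀ ≤ n → ∀ a : ℕ, k < a → k < n - a → ∀ σ τ : Equiv.Perm (Fin n), σ.cycleType = {n} → τ.cycleType = {a, n - a} → χ n σ = -χ n τ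

-- parent: TwoClassRigidity · child (gen 1)
/--     item stmt-ValiantsHypothesis-17992 · crux · rank 201 · open
    parent: TwoClassRigidity · by planner
    why it might fail: VP ≠ VBP may already show on the slice: a p-computable class-function GMF needing dc n^{ω(1)} (candidates sgn·F(c₁,c₂) with F non-polynomial in c₂, D^even_n, bounded-treewidth hom combinations DawarPagoSeppelt2025); no technique beats VSBR's dc ≤ n^O(log n) for circuits.
    sources: MalodPortier2008, Burgisser2000, MignonRessayre2004, DawarPagoSeppelt2025, RazYehudayoff2008, MahajanVinay1997
[crux] (X2a, COLLAPSE side of the VBP redirect of FermionicNormalForm) the class-function slice of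
VP lies in VBP: if χ_n are class functions on S_n and the GMF family f_n = Σ_σ χ_n(σ) Π_i X_{σ(i),i}
is p-computable over ℂ, then f_n has affine determinantal representations of p-bounded size, dc(f_n)
≤ n^c + c (Literature HasDetRepr; VBP = p-bounded dc, MalodPortier2008/Toda). A graded VP→VBP
collapse on the slice, i.e. an UPPER-bound statement; consistent with VP ℂ = VNP ℂ (world VBP = VP =
VNP), so not the summit: SliceVPInVBP → VH would be a proof of DcPerSuperpolynomial ℂ
(kernel-checked: SliceVPInVBP → DcPerSuperpolynomial ℂ → VH, strategist file
Cruxes/FermionicNormalForm/Split/SliceVBP.lean). Every class-function GMF KNOWN to be in VP is a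
short twisted-determinant sum and has POLYNOMIAL dc. -/
@[route_item "route-ValiantsHypothesis-ImmanantSlice"]
def SliceVBP : Prop :=
  ∀ χ : (n : ℕ) → Equiv.Perm (Fin n) → ℂ, (∀ (n : ℕ) (σ τ : Equiv.Perm (Fin n)), χ n (τ * σ * τ⁻¹) = χ n σ) → Literature.Computability.AlgebraicComplexity.IsPComputable (fun n => ∑ σ : Equiv.Perm (Fin n), MvPolynomial.C (χ n σ) * ∏ i : Fin n, (MvPolynomial.X (σ i, i) : MvPolynomial (Fin n × Fin n) ℂ)) → ∃ c : ℕ, ∀ n : ℕ, ∃ m ≤ n ^ c + c, Literature.Computability.AlgebraicComplexity.HasDetRepr (∑ σ : Equiv.Perm (Fin n), MvPolynomial.C (χ n σ) * ∏ i : Fin n, (MvPolynomial.X (σ i, i) : MvPolynomial (Fin n × Fin n) ℂ)) m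

-- parent: TwoClassRigidity · child (gen 1)
/--     item stmt-ValiantsHypothesis-21291 · crux · rank 202 · open
    parent: TwoClassRigidity · by planner
    why it might fail: At least perm-vs-det (χ ≡ 1). Refuted by a polynomial determinantal expression for any class-function family separating (n) from (a,n−a) beyond sign: T_n = Σ sgn·c(σ)x^σ (∓1 vs ±2) or D^even_n (−1 vs 0, a odd) — dc kill switches already in tree.
    sources: Valiant1979, MignonRessayre2004, LandsbergGCT2017, Curticapean2021, MertensMoore2013
[crux — split child 2 of TwoClassRigidity (crux-strategist BC2 redirect
Cruxes/TwoClassRigidity/SplitChildren.md verbatim)] DC TWO-CLASS RIGIDITY = the support item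
DeterminantalRigidity restricted to permutations with at most two cycles: for every family of class
functions χ_n whose generalized matrix functions have p-bounded affine determinantal complexity
there are k, n₀ such that for n ≥ n₀, χ_n = c_n · sgn on the ≤2-cycle part of Π_k(n)
(fixed-point-free, all cycles longer than k). Placement
(Theorems/ImmanantSliceTwoClassRigiditySplit.lean): TwoClassRigidity → this
(dcTwoClassRigidity_of_twoClassRigidity, a genuine weakening of the parent), DeterminantalRigidity →
this, this → DcPerSuperpolynomial ℂ (Valiant's permanent-versus-determinant conjecture, VNP ⊄ VBP —
it does NOT give VH). VP≠VNP is not proved by any item here. -/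
@[route_item "route-ValiantsHypothesis-ImmanantSlice"]
def DcTwoClassRigidity : Prop :=
  ∀ χ : (n : ℕ) → Equiv.Perm (Fin n) → ℂ, (∀ n (σ τ : Equiv.Perm (Fin n)), IsConj σ τ → χ n σ = χ n τ) → Literature.Computability.AlgebraicComplexity.IsPBounded (fun n => Literature.Computability.AlgebraicComplexity.determinantalComplexity (∑ σ : Equiv.Perm (Fin n), MvPolynomial.C (χ n σ) * ∏ i : Fin n, MvPolynomial.X (σ i, i))) → ∃ k n₀ : ℕ, ∀ n, n₀ ≤ n → ∃ c : ℂ, ∀ σ : Equiv.Perm (Fin n), (∀ i, σ i ≠ i) → (∀ m ∈ σ.cycleType, k < m) → Multiset.card σ.cycleType ≤ 2 → χ n σ = c * ((Equiv.Perm.sign σ : ℤ) : ℂ)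

-- parent: TwoClassRigidity · glue (gen 1)
/--     item stmt-ValiantsHypothesis-21292 · support · rank 203 · closed · proved by Summit.ValiantsHypothesis.Theorems.TwoClassRigiditySplit.twoClassRigidityOfDcSplit_proof (prover)
    parent: TwoClassRigidity · GLUE: children ⟹ parent · by planner
SliceVBP → DcTwoClassRigidity → TwoClassRigidity: a VP class-function family has p-bounded dc
(SliceVBP, = TwistedDetRank stmt-17992 verbatim), hence is eventually c·sgn on the ≤2-cycle part of
Π_k(n) (DcTwoClassRigidity); an n-cycle σ and a permutation τ of type (a, n−a), k < a, k < n−a, lie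
there with sgn τ = −sgn σ, so χ σ = −χ τ. PROVED — landed
Theorems/ImmanantSliceTwoClassRigiditySplit.lean (val-width-assembly-p1): theorem
Summit.ValiantsHypothesis.Theorems.TwoClassRigiditySplit.twoClassRigidity_of_sliceVPInVBP_of_dcTwoClassRigidity
has exactly these two hypotheses verbatim and conclusion TwoClassRigidity (its module imports the
route file, so --glue-by is unavailable); close this glue item with: ledger workitem close <item>
--as proved --by
Summit.ValiantsHypothesis.Theorems.TwoClassRigiditySplit.twoClassRigidity_of_sliceVPInVBP_of_dcTwoClassRigidity -/
@[route_item "route-ValiantsHypothesis-ImmanantSlice"]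
def TwoClassRigidityOfDcSplit : Prop :=
  SliceVBP → DcTwoClassRigidity → TwoClassRigidity

-- `TwoClassRigidityOfDcSplit` holds: proved by `Summit.ValiantsHypothesis.Theorems.TwoClassRigiditySplit.twoClassRigidityOfDcSplit_proof` (its module imports this route file, so no `_holds` link can be stated here).

/-- item stmt-ValiantsHypothesis-4210 · aside · rank 3 · open · by planner
why it might fail: fails iff VH holds but CR does not: a non-sign-like class-function family of INTERMEDIATE complexity (Bürgisser's Ladner-type families exist in VNP∖VP under VH, Burgisser2000 Ch. 5) sitting on the slice; sparse 'infinitely often' violations may defeat uniform reductions.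
sources: Curticapean2021, Burgisser2000, Burgisser2000Immanants, MertensMoore2013, Valiant1979
[crux] the hard direction of a CLASS-FUNCTION dichotomy (Curticapean2021 Thm 1 is the character
case), in implication form: if a p-family of class functions χ_n is NOT eventually sign-like on any
Π_k (for every k, n₀ some n ≥ n₀ where χ_n|Π_k(n) is not a multiple of sgn) and (d_{χ_n}) ∈ VP, then
the permanent is p-computable. Equivalent to (VH → CR): it says CR costs nothing beyond VH; intended
proofs are c-reductions per ≤ d_χ (gadgets + interpolation along the F(c_1)-twist and j-cycle
insertions). [difficulty: XL] -/
@[route_item "route-ValiantsHypothesis-ImmanantSlice"]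
def PermanentDominance : Prop :=
  ∀ χ : (n : ℕ) → Equiv.Perm (Fin n) → ℂ, (∀ n (σ τ : Equiv.Perm (Fin n)), IsConj σ τ → χ n σ = χ n τ) → (∀ k n₀ : ℕ, ∃ n, n₀ ≤ n ∧ ∀ c : ℂ, ∃ σ : Equiv.Perm (Fin n), (∀ i, σ i ≠ i) ∧ (∀ m ∈ σ.cycleType, k < m) ∧ χ n σ ≠ c * ((Equiv.Perm.sign σ : ℤ) : ℂ)) → Literature.Computability.AlgebraicComplexity.IsVPFamily (fun n => ∑ σ : Equiv.Perm (Fin n), MvPolynomial.C (χ n σ) * ∏ i : Fin n, MvPolynomial.X (σ i, i)) → Literature.Computability.AlgebraicComplexity.IsPComputable (fun n => Literature.Computability.AlgebraicComplexity.perPoly (Fin n) ℂ)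

/-- item stmt-ValiantsHypothesis-4211 · banked · rank 4 · closed · proved by Summit.ValiantsHypothesis.ValiantsHypothesis.Theorems.ImmanantSlice.evenCycleDominance_proof (prover) · by planner
why it might fail: D^even = [z^{[n]}]√(det(I−(ZX)²)) may carry a Pfaffian-type polynomial-size formula for general X (it is Pf² on skew X; even directed circuits have Pfaffian-orientation structure, RobertsonSeymourThomas1999) — then it is VP-cheap and no reduction exists unless VH fails.
sources: MertensMoore2013, Curticapean2021, RobertsonSeymourThomas1999, Valiant1979
[crux] the prime suspect is permanent-hard: if the signed even-cycle-cover family D^even_n = Σ_{σ ∈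
S_n, no fixed points, all cycles even} sgn(σ) Π x_{σ(i),i} (χ = sgn·[all cycles even], a class
function violating sign-likeness at every even n; equals det on skew-symmetric X) is in VP then per
is p-computable. First instance of PermanentDominance beyond characters and the fermionant line; a
gadget/interpolation reduction in the style of Curticapean2021 §1.2 / MertensMoore2013 is the
intended proof. [difficulty: L] -/
@[route_item "route-ValiantsHypothesis-ImmanantSlice", crux]
def EvenCycleDominance : Prop :=
  Literature.Computability.AlgebraicComplexity.IsVPFamily (fun n => ∑ σ : Equiv.Perm (Fin n), MvPolynomial.C (if (∀ i, σ i ≠ i) ∧ (∀ m ∈ σ.cycleType, Even m) then (((Equiv.Perm.sign σ : ℤ) : ℂ)) else 0) * ∏ i : Fin n, MvPolynomial.X (σ i, i)) → Literature.Computability.AlgebraicComplexity.IsPComputable (fun n => Literature.Computability.AlgebraicComplexity.perPoly (Fin n) ℂ)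

-- `EvenCycleDominance` holds: proved by `Summit.ValiantsHypothesis.ValiantsHypothesis.Theorems.ImmanantSlice.evenCycleDominance_proof` (its module imports this route file, so no `_holds` link can be stated here).

-- earlier MonotoneRigidity (stmt-ValiantsHypothesis-4212, replaced 2026-08-15T16:16:04Z -> stmt-ValiantsHypothesis-10453): retired by None — ∀ χ : (n : ℕ) → Equiv.Perm (Fin n) → NNReal, (∀ n (σ τ : Equiv.Perm (Fin n)), IsConj σ τ → χ n σ = χ n τ) → (∃ s : ℕ → ℕ, Literature.Computability.AlgebraicComplexity.IsPBounded s ∧ ∀ n, ∃ P : Literature.Computability.AlgebraicComplexity.ArithCircuit NNReal (Fi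
/-- item stmt-ValiantsHypothesis-10453 · banked · rank 5 · closed · proved by Summit.ValiantsHypothesis.ValiantsHypothesis.Theorems.ImmanantSlice.monotoneRigidity_proof (prover) · by planner
why it might fail: JS counting is per-polynomial: block gadgets project d_χ only to another d_{χ''} with χ''(id) > 0 (cheap when χ'' = δ_id), not to per_t, so mixed cycle types (t ≈ L ≈ √n) need a new support-insensitive 2^{Ω(n^{1/3})} bound; a positive cheap example would refute CR itself.
sources: JerrumSnir1982, Valiant1980, Curticapean2021
[crux] the monotone shadow of CR (a necessary condition for CR, since a monotone circuit over ℝ≥0 is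
a circuit over ℂ and a nonnegative χ positive on a long-cycle class is never c·sgn): if χ_n : S_n →
ℝ≥0 are class functions and d_{χ_n} has Jerrum–Snir monotone computations of p-bounded size —
fan-in-two circuits over the semiring (ℝ≥0,+,·) whose sum gates are plain (all coefficients 1;
constants enter as inputs), computing d_{χ_n} exactly; this is
`Literature.Barriers.ValiantsHypothesis.IsMonotoneComputation` UNFOLDED IN PLACE so that the route
no longer imports the barrier file MonotoneGap (route-repair 2026-08-15: equivalence with the
previously filed spelling proved as `monotoneRigidity_iff_old` in the planner's Sketch.lean; provers
may still import Literature.Barriers.ValiantsHypothesis.MonotoneGapDecomposition etc. and recover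
`IsPlain P` by `cases g`) — then for some k and all large n, χ_n vanishes on Π_k(n). Card support
(c). [difficulty: M] -/
@[route_item "route-ValiantsHypothesis-ImmanantSlice"]
def MonotoneRigidity : Prop :=
  ∀ χ : (n : ℕ) → Equiv.Perm (Fin n) → NNReal, (∀ n (σ τ : Equiv.Perm (Fin n)), IsConj σ τ → χ n σ = χ n τ) → (∃ s : ℕ → ℕ, Literature.Computability.AlgebraicComplexity.IsPBounded s ∧ ∀ n, ∃ P : Literature.Computability.AlgebraicComplexity.ArithCircuit NNReal (Fin n × Fin n), P.IsFanInTwo ∧ (∀ g ∈ P.gates, ∀ args, g = Literature.Computability.AlgebraicComplexity.ArithCircuit.Gate.sum args → ∀ a ∈ args, a.1 = 1) ∧ P.Computes (∑ σ : Equiv.Perm (Fin n), MvPolynomial.C (χ n σ) * ∏ i : Fin n, MvPolynomial.X (σ i, i)) ∧ P.size ≤ s n) → ∃ k n₀ : ℕ, ∀ n, n₀ ≤ n → ∀ σ : Equiv.Perm (Fin n), (∀ i, σ i ≠ i) → (∀ m ∈ σ.cycleType, k < m) → χ n σ = 0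

-- `MonotoneRigidity` holds: proved by `Summit.ValiantsHypothesis.ValiantsHypothesis.Theorems.ImmanantSlice.monotoneRigidity_proof` (its module imports this route file, so no `_holds` link can be stated here).

/-- item stmt-ValiantsHypothesis-4213 · support · rank 9 · open · by planner
sources: MignonRessayre2004, Valiant1979, Curticapean2021
[support] the VBP special case of CR (weaker statement, implies VBP ≠ VNP): class-function families
whose d_χ have p-bounded affine determinantal complexity are eventually sign-like on some Π_k.
[difficulty: open-problem] -/
@[route_item "route-ValiantsHypothesis-ImmanantSlice", crux]
def DeterminantalRigidity : Prop :=
  ∀ χ : (n : ℕ) → Equiv.Perm (Fin n) → ℂ, (∀ n (σ τ : Equiv.Perm (Fin n)), IsConj σ τ → χ n σ = χ n τ) → Literature.Computability.AlgebraicComplexity.IsPBounded (fun n => Literature.Computability.AlgebraicComplexity.determinantalComplexity (∑ σ : Equiv.Perm (Fin n), MvPolynomial.C (χ n σ) * ∏ i : Fin n, MvPolynomial.X (σ i, i))) → ∃ k n₀ : ℕ, ∀ n, n₀ ≤ n → ∃ c : ℂ, ∀ σ : Equiv.Perm (Fin n), (∀ i, σ i ≠ i) → (∀ m ∈ σ.cycleType,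 k < m) → χ n σ = c * ((Equiv.Perm.sign σ : ℤ) : ℂ)

/-- item stmt-ValiantsHypothesis-4214 · aside · rank 9 · open · by planner
sources: MertensMoore2013, RobertsonSeymourThomas1999
[support] CR's sharpest single prediction, filed so that its REFUTATION (D^even ∈ VP, the route's
kill switch) has a decl to close: the signed even-cycle-cover family is not in VP. [difficulty:
open-problem] -/
@[route_item "route-ValiantsHypothesis-ImmanantSlice", crux]
def EvenCycleCoverNotVP : Prop :=
  ¬ Literature.Computability.AlgebraicComplexity.IsVPFamily (fun n => ∑ σ : Equiv.Perm (Fin n), MvPolynomial.C (if (∀ i, σ i ≠ i) ∧ (∀ m ∈ σ.cycleType, Even m) then (((Equiv.Perm.sign σ : ℤ) : ℂ)) else 0) * ∏ i : Fin n, MvPolynomial.X (σ i, i))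

/-- item stmt-ValiantsHypothesis-4215 · support · rank 9 · closed · proved by Summit.ValiantsHypothesis.Theorems.ImmanantSliceAlphaPencil.alphaPencil_proof @ 08cf65c9d381 (prover) · by planner
sources: MertensMoore2013, DeRugyAltherre2013, Burgisser2000
[support] α-pencil interpolation lemma (card (6), rigorous): if for some c and every n at least n+1
distinct α ∈ ℂ have L(per_{α,n}) ≤ n^c + c, where per_{α,n} = Σ_σ α^{#cycles(σ)} x^σ (cycles counted
with fixed points), then the permanent is p-computable (Lagrange interpolation in α recovers every
C_k = Σ_{c(σ)=k} x^σ, hence per_n = Σ_k C_k, with complexity_add_le/smul_le). [difficulty: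
provable-now] -/
@[route_item "route-ValiantsHypothesis-ImmanantSlice"]
def AlphaPencil : Prop :=
  (∃ c : ℕ, ∀ n : ℕ, ∃ S : Finset ℂ, n < S.card ∧ ∀ α ∈ S, Literature.Computability.AlgebraicComplexity.complexity (∑ σ : Equiv.Perm (Fin n), MvPolynomial.C (α ^ (σ.cycleType.card + (Finset.univ.filter fun i : Fin n => σ i = i).card)) * ∏ i : Fin n, MvPolynomial.X (σ i, i)) ≤ n ^ c + c) → Literature.Computability.AlgebraicComplexity.IsPComputable (fun n => Literature.Computability.AlgebraicComplexity.perPoly (Fin n) ℂ)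

-- `AlphaPencil` holds: proved by `Summit.ValiantsHypothesis.Theorems.ImmanantSliceAlphaPencil.alphaPencil_proof` @ 08cf65c9d381 (its module imports this route file, so no `_holds` link can be stated here).

/-- item stmt-ValiantsHypothesis-4216 · support · rank 9 · closed · proved by Summit.ValiantsHypothesis.ValiantsHypothesis.Theorems.targetToTwoClass_proof @ 44b5522b1140 (prover) · by planner
sources: Burgisser2000
[support] CR implies the two-class form (sign bookkeeping: sgn of an n-cycle is (−1)^{n−1}, of type
(a, n−a) is (−1)^n; both classes lie in Π_k(n) when k < a, k < n−a; Equiv.Perm.sign_of_cycleType).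
[difficulty: provable-now] -/
@[route_item "route-ValiantsHypothesis-ImmanantSlice"]
def TargetToTwoClass : Prop :=
  CuspidalRigidity → TwoClassRigidity

-- `TargetToTwoClass` holds: proved by `Summit.ValiantsHypothesis.ValiantsHypothesis.Theorems.targetToTwoClass_proof` @ 44b5522b1140 (its module imports this route file, so no `_holds` link can be stated here).

/-- item stmt-ValiantsHypothesis-4217 · assembly · rank 1 · closed · proved by Summit.ValiantsHypothesis.ValiantsHypothesis.Theorems.immanantSlice_assembly_proof @ 0356ec2e7f25 (prover) · by planner
sources: Valiant1979, BurgisserClausenShokrollahi1997, Burgisser2000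
[assembly] TwoClassRigidity → ValiantsHypothesis (per = d_1; the classes (n) and (k+1, n−k−1) have
opposite signs; hub lemma + Valiant's per ∈ VNP). -/
@[route_item "route-ValiantsHypothesis-ImmanantSlice"]
def Assembly : Prop :=
  TwoClassRigidity → ValiantsHypothesis

-- `Assembly` holds: proved by `Summit.ValiantsHypothesis.ValiantsHypothesis.Theorems.immanantSlice_assembly_proof` @ 0356ec2e7f25 (its module imports this route file, so no `_holds` link can be stated here).

/-! D-0027 §2.1 — DECIDING THEOREM (planner-authored via `route open/edit --closes-file`; by planner-rbadge-ValiantsHypothesis-ImmanantSlic-220df893-g2-0 2026-08-15T16:17:04Z):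
its hypotheses are this route's items and its conclusion the sub-problem Statement (glue_lint), and it elaborates with this file. -/

/-- DECIDING THEOREM (D-0027 §2.1). The single load-bearing crux `TwoClassRigidity` already gives
`VP_ℂ ≠ VNP_ℂ`: if `VP ℂ = VNP ℂ` then Valiant's `per ∈ VNP` (`perFamily_mem_VNP_holds`) and the
bundling bridge (`mem_VP_ofFintype_iff_holds`) make `(per_n)` a `VP` family; `per_n = d_χ` for the
class function `χ ≡ 1` (`C 1 * ∏ X (σ i, i)`, `Matrix.permanent` of `mvPolynomialX`), so
`TwoClassRigidity` yields `k, n₀` with `χ(n-cycle) = -χ(type (a, n-a))` for `n ≥ n₀`, `k < a`,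
`k < n - a`; at `n = n₀ + 2k + 4`, `a = k + 2` both cycle types are realised
(`Equiv.Perm.exists_with_cycleType_iff`) and we get `1 = -1` in `ℂ`. Axioms: propext,
Classical.choice, Quot.sound. -/
@[closes "route-ValiantsHypothesis-ImmanantSlice"] theorem closes (h_TwoClassRigidity : TwoClassRigidity) : _root_.ValiantsHypothesis := by
  classical
  show Literature.Computability.AlgebraicComplexity.VP ℂ ≠ Literature.Computability.AlgebraicComplexity.VNP ℂ
  intro hEq
  have hVNP := Literature.Computability.AlgebraicComplexity.perFamily_mem_VNP_holds ℂ
  have hVP : Literature.Computability.AlgebraicComplexity.perFamily ℂ ∈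
      Literature.Computability.AlgebraicComplexity.VP ℂ := by rw [hEq]; exact hVNP
  have hfam : Literature.Computability.AlgebraicComplexity.IsVPFamily
      (fun n => Literature.Computability.AlgebraicComplexity.perPoly (Fin n) ℂ) :=
    (Literature.Computability.AlgebraicComplexity.mem_VP_ofFintype_iff_holds _).1 hVP
  have hper : (fun n => ∑ σ : Equiv.Perm (Fin n),
      MvPolynomial.C ((fun (m : ℕ) (_ : Equiv.Perm (Fin m)) => (1 : ℂ)) n σ) *
        ∏ i : Fin n, MvPolynomial.X (σ i, i)) =
      fun n => Literature.Computability.AlgebraicComplexity.perPoly (Fin n) ℂ := by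
    funext n
    simp [Literature.Computability.AlgebraicComplexity.perPoly, Matrix.permanent, Matrix.mvPolynomialX]
  have hfam' : Literature.Computability.AlgebraicComplexity.IsVPFamily (fun n => ∑ σ : Equiv.Perm (Fin n),
      MvPolynomial.C ((fun (m : ℕ) (_ : Equiv.Perm (Fin m)) => (1 : ℂ)) n σ) *
        ∏ i : Fin n, MvPolynomial.X (σ i, i)) := by
    rw [hper]; exact hfam
  obtain ⟨k, n₀, hk⟩ := h_TwoClassRigidity (fun (m : ℕ) (_ : Equiv.Perm (Fin m)) => (1 : ℂ))
    (fun _ _ _ _ => rfl) hfam'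
  obtain ⟨N, hN⟩ : ∃ N : ℕ, N = n₀ + 2 * k + 4 := ⟨_, rfl⟩
  have h1 := hk N (by omega) (k + 2) (by omega) (by omega)
  obtain ⟨σ, hσ⟩ : ∃ σ : Equiv.Perm (Fin N), σ.cycleType = {N} :=
    (Equiv.Perm.exists_with_cycleType_iff (Fin N)).2
      ⟨by simp, by simp only [Multiset.mem_singleton, forall_eq]; omega⟩
  obtain ⟨τ, hτ⟩ : ∃ τ : Equiv.Perm (Fin N), τ.cycleType = {k + 2, N - (k + 2)} :=
    (Equiv.Perm.exists_with_cycleType_iff (Fin N)).2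
      ⟨by simp only [Multiset.insert_eq_cons, Multiset.sum_cons, Multiset.sum_singleton, Fintype.card_fin]; omega,
       by simp only [Multiset.insert_eq_cons, Multiset.mem_cons, Multiset.mem_singleton]; rintro a (rfl | rfl) <;> omega⟩
  have h2 := h1 σ τ hσ hτ
  norm_num at h2

end Summit.ValiantsHypothesis.ValiantsHypothesis.Theses.ImmanantSlice
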